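import Summits.CriticalPhenomena.PercolationContinuityZ3.Theorems.PercNearOneGluingNoHeavyLowerTailMixCSHGadget
import Summits.CriticalPhenomena.PercolationContinuityZ3.Theorems.PercNearOneGluingNoHeavyLowerTailMixMetaA2
import HarnessLib

/-!
# Mixed conditioned slack hierarchy — LEMMA R⁻ (the remainder of the hub row of Lemma U is nonpositive), in the world `G[U]`

Support file (`--supports stmt-CriticalPhenomena-4575`), prover `prim-ineq-gen-7` (gen 9).  No definitions, no named facts, no sorries.
Memo `prim-ineq-gen-7/PROOF-Q9-MIXED-CSH.md` §3.3 (Lemma R⁻ — "the only genuinely new inequality" of the mixed hierarchy); blueprint §10 brick B3;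
write-up `Q9-WRITEUP.md` Lemma 5.5.

Setting (finite-sum framework, world `G[U]`, gadget `K = V ∖ U` = the deleted cluster of a decoy): owner `x`, avoided set `Y ⊆ Y' ⊆ U`
(`Y' = Y_j = {x} ∪ Y ∪ D_{<j}`), a vertex set `Σ` (the hub), a monotone `g ≥ 0`.
* `CovTau.metaA2_gain`, `CovTau.p1Gain` — META-A2 (`CovTau.metaA2_abstract`, gen 8) run with `(f₁,f₂,f₃,f₄) = (P_{Y'}, Y_{gain_K}, 1, Y_{P_{Y'}(∅)·gain_K})`
  (`CovTau.PavN`, `CovTau.gainF` of `…MixCSHGadget.lean`): `P_{Y'}(N)·Y_{gain}(N') ≤ Y_{P(∅)·gain}(N ∩ N')`, in particular (diagonal `N = N' = Y`)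
  `Cov_π(δ′, E[q | C_Y]) ≥ 0` for `δ′ = 1{x↮Y}·gain_K(U ∖ C_Y)` and `q = 1{Σ ↮ Y'}`.
* `CovTau.rminus_world` — **LEMMA R⁻**: with the GLOBAL residual `Θ = 1{x ↮ Y}·(g(C_x) − E_{G − C_Y} g(C_x))` (world mean in the FULL graph minus
  the `G[U]`-cluster of `Y`, gadget glued back) and `q = 1{Σ ↮ Y'}` read in `G[U]`:  `E_U[Θ·q] ≤ E_U[Θ]·E_U[q]`.
  Proof (memo §3.3): `Θ = Θ_U − δ′`; `E_U[Θ_U q] ≤ 0` (Markov at `C_Y`, `prim-hp-4`'s `CovTau.sum_cond_sC`, then Harris in the world `U ∖ C_Y`: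
  `g(C_x)` ↑, `1{Σ ↮ Y'}` ↓), `E_U[Θ_U] = 0`, and `E_U[δ′ q] ≥ E_U[δ′]·E_U[q]` is `p1Gain`.
The dictionary to the `CSH.resid` / `HullPort.cut` vocabulary of the unfolding (brick B2) is the sequel `…MixCSHRminus.lean`.
[cite: VandenbergHaggstromKahn2005, Thm. 1.1 (pp. 3–5), §1 display (4) (p. 4), identity (6) (p. 4), display (10) (pp. 7–8)]
[cite: KozmaNitzan2024, Question 9 (§5.5 p. 36)]
-/

noncomputable section

namespace Summit.CriticalPhenomena.PercolationContinuityZ3.Theorems.CovTau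

open Literature.Probability.Percolation
open Literature.Probability.Percolation.BHK2006
open Literature.Probability.Percolation.DecisionTree (ind ind_of_mem ind_of_not_mem ind_nonneg)
open scoped Classical

variable {V : Type*}

/-! ### Reading events of `G[U]` in the world `G[U ∖ C_Y]` -/

/-- `avoidAll U Σ X` only reads the pairs inside `U`. [folklore] -/
theorem ind_avoidAll_inter_edgesIn (U Sig : Finset V) (X : Set V) (ω : Set (Sym2 V)) :
    ind (avoidAll U Sig X) (ω ∩ edgesIn U) = ind (avoidAll U Sig X) ω := by
  have h : ω ∩ edgesIn U ∈ avoidAll U Sig X ↔ ω ∈ avoidAll U Sig X := by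
    simp only [mem_avoidAll, mem_rD_inter_edgesIn]
  by_cases hω : ω ∈ avoidAll U Sig X
  · rw [ind_of_mem hω, ind_of_mem (h.2 hω)]
  · rw [ind_of_not_mem hω, ind_of_not_mem (fun h' => hω (h.1 h'))]

/-- `avoidAll` is a decreasing event. [folklore] -/
theorem ind_avoidAll_antitone (U Sig : Finset V) (X : Set V) : Antitone (ind (avoidAll U Sig X)) := by
  intro ω ω' h
  by_cases hω' : ω' ∈ avoidAll U Sig X
  · rw [ind_of_mem hω', ind_of_mem (show ω ∈ avoidAll U Sig X from fun σ hσ => ⟨(hω' σ hσ).1, rD_decreasing h (hω' σ hσ).2⟩)]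
  · rw [ind_of_not_mem hω']; exact ind_nonneg _ _

/-- If some `σ ∈ Σ` is not a vertex of the world, `avoidAll` is empty there. [folklore] -/
theorem avoidAll_eq_empty_of_not_mem {U Sig : Finset V} {σ : V} (hσ : σ ∈ Sig) (hσU : σ ∉ U) (X : Set V) :
    avoidAll U Sig X = ∅ :=
  Set.eq_empty_of_forall_notMem fun _ hω => hσU (hω σ hσ).1

/-- **`{Σ ↮ Y'}` given the cluster `W = C_Y` of `Y ⊆ Y'` in `G[U]`**: no `σ ∈ Σ` lies in `W`, and `Σ ↮ Y'` in the world `G[U ∖ W]`. [folklore] -/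
theorem mem_avoidAll_iff_rest {U Sig : Finset V} {Y Y' : Set V} (hYY' : Y ⊆ Y') (ω : Set (Sym2 V)) :
    ω ∈ avoidAll U Sig Y' ↔ (∀ σ ∈ Sig, σ ∉ sC U Y ω) ∧ ω ∈ avoidAll (rest U Y ω) Sig Y' := by
  constructor
  · intro h
    have hW : ∀ σ ∈ Sig, σ ∉ sC U Y ω := fun σ hσ ⟨y, hy, hr⟩ => (h σ hσ).2 y (hYY' hy) hr.symm
    refine ⟨hW, fun σ hσ => ⟨mem_rest.2 ⟨(h σ hσ).1, hW σ hσ⟩, fun a ha hr => (h σ hσ).2 a ha ?_⟩⟩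
    exact hr.mono (openGraph_le (Set.inter_subset_inter_right _ (edgesIn_mono (rest_subset U Y ω))))
  · rintro ⟨hW, h⟩ σ hσ
    exact ⟨rest_subset U Y ω (h σ hσ).1, fun a ha hr => (h σ hσ).2 a ha ((reach_rest_iff (hW σ hσ)).2 hr)⟩

/-- Vertices outside the world are isolated: for `Y' ⊆ U`, `{Σ ↮ Y'}` in `G[U]` is `avoidAll U (Σ ∩ U) Y'`. [folklore] -/
theorem ind_setAvoid_eq_avoidAll (U Sig : Finset V) {Y' : Set V} (hY'U : Y' ⊆ ↑U) (η : Set (Sym2 V)) :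
    ind {ζ : Set (Sym2 V) | ∀ σ ∈ Sig, ∀ a ∈ Y', ¬ (openGraph (ζ ∩ edgesIn U)).Reachable σ a} η =
      ind (avoidAll U (Sig.filter fun σ => σ ∈ U) Y') η := by
  have hiff : η ∈ {ζ : Set (Sym2 V) | ∀ σ ∈ Sig, ∀ a ∈ Y', ¬ (openGraph (ζ ∩ edgesIn U)).Reachable σ a} ↔
      η ∈ avoidAll U (Sig.filter fun σ => σ ∈ U) Y' := by
    simp only [Set.mem_setOf_eq, mem_avoidAll, Finset.mem_filter]
    constructor
    · rintro h σ ⟨hσ, hσU⟩; exact ⟨hσU, h σ hσ⟩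
    · intro h σ hσ a ha hr
      by_cases hσU : σ ∈ U
      · exact (h σ ⟨hσ, hσU⟩).2 a ha hr
      · rw [SimpleGraph.reachable_iff_reflTransGen] at hr
        rcases hr.cases_head with hh | ⟨b, hab, -⟩
        · exact hσU (hh ▸ hY'U ha)
        · exact hσU (adj_iff.1 hab).2.1.1
  by_cases h : η ∈ avoidAll U (Sig.filter fun σ => σ ∈ U) Y'
  · rw [ind_of_mem h, ind_of_mem (hiff.2 h)]
  · rw [ind_of_not_mem h, ind_of_not_mem (fun h' => h (hiff.1 h'))]

/-- The full vertex set minus the cluster of `Y` in `G[U]` is `(U ∖ C_Y) ∪ (V ∖ U)`. [folklore] -/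
theorem univ_filter_not_mem_sC [Fintype V] {U : Finset V} {Y : Set V} (hYU : Y ⊆ ↑U) (η : Set (Sym2 V)) :
    (Finset.univ.filter fun u => u ∉ sC U Y η) = rest U Y η ∪ (Finset.univ \ U) := by
  ext a
  simp only [Finset.mem_filter, Finset.mem_univ, true_and, Finset.mem_union, mem_rest, Finset.mem_sdiff]
  constructor
  · intro h
    by_cases haU : a ∈ U
    · exact Or.inl ⟨haU, h⟩
    · exact Or.inr haU
  · rintro (⟨-, h⟩ | h)
    · exact h
    · exact fun haC => h (sC_subset_of_subset hYU η haC)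

/-- `1{x ∉ W}` at `W = C_N` is `1{x ↮ N}`. [folklore] -/
theorem ind_not_mem_sC_eq (U : Finset V) (x : V) (N : Set V) (ω : Set (Sym2 V)) :
    ind {W : Set V | x ∉ W} (sC U N ω) = ind (rD U x N) ω := by
  by_cases h : x ∈ sC U N ω
  · rw [ind_of_not_mem (show sC U N ω ∉ {W : Set V | x ∉ W} from fun h' => h' h),
      ind_of_not_mem (fun h' => ((not_mem_sC_iff U N ω x).2 h') h)]
  · rw [ind_of_mem (show sC U N ω ∈ {W : Set V | x ∉ W} from h), ind_of_mem ((not_mem_sC_iff U N ω x).1 h)]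

variable [Fintype V]

/-- **Markov for `E_{G[U]} g(C_x)` along the cluster of `N`**: `E[1{x↮N} g(C_x)] = E[1{x↮N}·E_{G[U∖C_N]} g(C_x)]`.
[cite: VandenbergHaggstromKahn2005, §1 pp. 7–8, display (10)] -/
theorem sum_ind_rD_mul_g_rC (w : Sym2 V → ℝ) (hm : ∑ ω, weight w ω = 1) (U : Finset V) (x : V) (N : Set V)
    (g : Set (Sym2 V) → ℝ) :
    ∑ ω, weight w ω * (ind (rD U x N) ω * g (rC U x ω)) = ∑ ω, weight w ω * (ind (rD U x N) ω * tfE w (rest U N ω) x g) := by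
  have markov := sum_cond_sC w hm U N (fun W η => ind {W : Set V | x ∉ W} W * g (rC (U.filter fun a => a ∉ W) x η))
  refine (Eq.trans ?_ markov).trans ?_
  · refine Finset.sum_congr rfl fun ω _ => ?_
    rw [ind_not_mem_sC_eq, ← rest_eq_filter, rC_inter_edgesIn]
    by_cases hx : x ∈ sC U N ω
    · rw [ind_of_not_mem (fun h' => ((not_mem_sC_iff U N ω x).2 h') hx), zero_mul, zero_mul]
    · rw [rC_rest_of_not_mem hx]
  · refine Finset.sum_congr rfl fun ω _ => ?_
    rw [ind_not_mem_sC_eq, ← rest_eq_filter]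
    congr 1
    rw [tfE, Finset.mul_sum]
    exact Finset.sum_congr rfl fun η _ => by rw [rC_inter_edgesIn]; ring

/-! ### META-A2 for the gain functional -/

/-- **META-A2 with the gain-from-gadget functional** (memo §3.3 (b)): for every world `U` disjoint from the gadget `K` and all `N, N' ⊆ U`,
`P_X(N) · Y_{gain}(N') ≤ Y_{P_X(∅)·gain}(N ∩ N')` — `CovTau.metaA2_abstract` with `(f₁, f₂, f₃, f₄) = (P_X, Y_{gain}, 1, Y_{P_X(∅)·gain})`.
[cite: VandenbergHaggstromKahn2005, Thm. 1.1 (pp. 3–5), §1 identity (6) (p. 4)] [cite: KozmaNitzan2024, Question 9 (§5.5 p. 36)] -/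
theorem metaA2_gain (w : Sym2 V → ℝ) (hw0 : ∀ e, 0 ≤ w e) (hw1 : ∀ e, w e ≤ 1) (hm : ∑ ω, weight w ω = 1)
    (K : Finset V) (x : V) {g : Set (Sym2 V) → ℝ} (hg : Monotone g) (Sig : Finset V) (X : Set V) (U : Finset V)
    (hK : Disjoint U K) :
    ∀ N N' : Set V, N ⊆ ↑U → N' ⊆ ↑U →
      PavN w U Sig X N * Yw w U x (gainF w K x g) N' ≤
        Yw w U x (fun U' => PavN w U' Sig X ∅ * gainF w K x g U') (N ∩ N') := by
  have hF0 := gainF_nonneg hw0 hw1 K x hg (w := w)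
  have hq0 : ∀ U' : Finset V, 0 ≤ PavN w U' Sig X ∅ * gainF w K x g U' := fun U' =>
    mul_nonneg (PavN_nonneg hw0 hw1 U' Sig X ∅) (hF0 U')
  have key := metaA2_abstract w hw0 hw1 hm (fun _ Z => x ∉ Z)
    (fun U' N => PavN w U' Sig X N) (fun U' N => Yw w U' x (gainF w K x g) N) (fun _ _ => (1 : ℝ))
    (fun U' N => Yw w U' x (fun U'' => PavN w U'' Sig X ∅ * gainF w K x g U'') N)
    (fun U' N => PavN_nonneg hw0 hw1 U' Sig X N) (fun U' N => Yw_nonneg hw0 hw1 U' x hF0 N)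
    (fun _ _ => zero_le_one) (fun U' N => Yw_nonneg hw0 hw1 U' x hq0 N) U ?_ ?_ ?_ ?_ ?_ ?_ ?_ ?_
  · intro N N' hN hN'
    simpa only [one_mul] using key N N' hN hN'
  · -- admissibility: `x ∉ Z` from `Y ≠ 0`
    intro U' _ N N' _ _ hne Z _ hZ hxZ
    have h2 : Yw w U' x (gainF w K x g) N' ≠ 0 := fun h => hne (by rw [h, mul_zero])
    exact h2 (Yw_eq_zero_of_mem w U' x _ (hZ (Finset.mem_coe.2 hxZ)).2)
  · intro U' _ Z hZU' _ _ N hZN _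
    exact PavN_step hZU' Sig hZN w hm
  · intro U' _ Z hZU' hxZ _ N hZN _
    exact Yw_step hZU' hxZ hZN w hm _
  · intro U' _ Z _ _ _ N _ _
    rw [← Finset.sum_mul, hm, one_mul]
  · intro U' _ Z hZU' hxZ _ N hZN _
    exact Yw_step hZU' hxZ hZN w hm _
  · intro U' _ N N' hNN' _
    exact PavN_antitone hw0 hw1 U' Sig X hNN'
  · intro U' hU' N N' hNN' hN'U'
    exact Yw_gainF_antitone w hw0 hw1 hm K x hg (Finset.disjoint_of_subset_left hU' hK) hNN' hN'U'
  · -- disjoint sources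
    intro U' hU' N N' _ hN'U' _
    rw [Yw_empty w hm, one_mul]
    have h1 : PavN w U' Sig X N ≤ PavN w U' Sig X ∅ := PavN_antitone hw0 hw1 U' Sig X (Set.empty_subset N)
    have h2 : Yw w U' x (gainF w K x g) N' ≤ gainF w K x g U' := by
      have h := Yw_gainF_antitone w hw0 hw1 hm K x hg (Finset.disjoint_of_subset_left hU' hK) (Set.empty_subset N') hN'U'
      rwa [Yw_empty w hm] at h
    exact mul_le_mul h1 h2 (Yw_nonneg hw0 hw1 U' x hF0 N') (PavN_nonneg hw0 hw1 U' Sig X ∅)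

/-- **The diagonal**: `P_X(Y)·Y_{gain}(Y) ≤ Y_{P_X(∅)·gain}(Y)` in every world disjoint from the gadget — the META-A2 input of Lemma R⁻ (b),
`Cov_π(δ′, E[q | C_Y]) ≥ 0`. [cite: VandenbergHaggstromKahn2005, Thm. 1.1 (pp. 3–5)] [cite: KozmaNitzan2024, Question 9 (§5.5 p. 36)] -/
theorem p1Gain (w : Sym2 V → ℝ) (hw0 : ∀ e, 0 ≤ w e) (hw1 : ∀ e, w e ≤ 1) (hm : ∑ ω, weight w ω = 1)
    (K : Finset V) (x : V) {g : Set (Sym2 V) → ℝ} (hg : Monotone g) (Sig : Finset V) (X : Set V) {U : Finset V}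
    (hK : Disjoint U K) {Y : Set V} (hY : Y ⊆ ↑U) :
    PavN w U Sig X Y * Yw w U x (gainF w K x g) Y ≤ Yw w U x (fun U' => PavN w U' Sig X ∅ * gainF w K x g U') Y := by
  have h := metaA2_gain w hw0 hw1 hm K x hg Sig X U hK Y Y hY hY
  rwa [Set.inter_self] at h

/-! ### Lemma R⁻ in the world `G[U]` -/

/-- **LEMMA R⁻ in the world `G[U]`** (memo §3.3): for `Y ⊆ Y' ⊆ U`, a vertex set `Σ` and a monotone `g ≥ 0`, the GLOBAL residual
`Θ = 1{x ↮ Y}·(g(C_x) − E_{G − C_Y} g(C_x))` (the world mean is taken in the FULL graph minus the `G[U]`-cluster of `Y`: the gadget `V ∖ U` is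
glued back) is negatively correlated in `G[U]` with `q = 1{Σ ↮ Y'}`:  `E_U[Θ q] ≤ E_U[Θ]·E_U[q]`.
Proof: `Θ = Θ_U − δ′`, `Θ_U` the `G[U]`-residual (given `C_Y`: Harris ⇒ `Cov ≤ 0`, and `E_U[Θ_U] = 0`), `δ′ = 1{x↮Y}·gain_{V∖U}(U ∖ C_Y)`,
and `E_U[δ′ q] ≥ E_U[δ′]·E_U[q]` is `p1Gain`. [cite: VandenbergHaggstromKahn2005, Thm. 1.1 (pp. 3–5), §1 display (4) (p. 4), display (10) (pp. 7–8)]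
[cite: KozmaNitzan2024, Question 9 (§5.5 p. 36)] -/
theorem rminus_world (w : Sym2 V → ℝ) (hw0 : ∀ e, 0 ≤ w e) (hw1 : ∀ e, w e ≤ 1) (hm : ∑ ω, weight w ω = 1)
    (x : V) {Y Y' : Set V} (hYY' : Y ⊆ Y') {U : Finset V} (hY'U : Y' ⊆ ↑U) (Sig : Finset V)
    {g : Set (Sym2 V) → ℝ} (hg : Monotone g) (hg0 : ∀ C, 0 ≤ g C) :
    ∑ η, weight w η * (ind (rD U x Y) η * (g (rC U x η) - tfE w (Finset.univ.filter fun u => u ∉ sC U Y η) x g) *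
        ind {ζ : Set (Sym2 V) | ∀ σ ∈ Sig, ∀ a ∈ Y', ¬ (openGraph (ζ ∩ edgesIn U)).Reachable σ a} η) ≤
      (∑ η, weight w η * (ind (rD U x Y) η * (g (rC U x η) - tfE w (Finset.univ.filter fun u => u ∉ sC U Y η) x g))) *
        ∑ η, weight w η * ind {ζ : Set (Sym2 V) | ∀ σ ∈ Sig, ∀ a ∈ Y', ¬ (openGraph (ζ ∩ edgesIn U)).Reachable σ a} η := by
  have hYU : Y ⊆ ↑U := hYY'.trans hY'U
  set K : Finset V := Finset.univ \ U with hK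
  have hUK : Disjoint U K := Finset.disjoint_sdiff
  set ΘU : Set (Sym2 V) → ℝ := fun η => ind (rD U x Y) η * (g (rC U x η) - tfE w (rest U Y η) x g) with hΘU
  set δ : Set (Sym2 V) → ℝ := fun η => ind (rD U x Y) η * gainF w K x g (rest U Y η) with hδ
  have hsplit : ∀ η : Set (Sym2 V),
      ind (rD U x Y) η * (g (rC U x η) - tfE w (Finset.univ.filter fun u => u ∉ sC U Y η) x g) = ΘU η - δ η := by
    intro η
    simp only [hΘU, hδ, gainF, univ_filter_not_mem_sC hYU η]
    ring
  simp only [ind_setAvoid_eq_avoidAll U Sig hY'U, hsplit]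
  set Sig' : Finset V := Sig.filter fun σ => σ ∈ U with hSig'
  set q : Set (Sym2 V) → ℝ := ind (avoidAll U Sig' Y') with hq
  -- `q` given the cluster of `Y`
  have hqη : ∀ η : Set (Sym2 V), q η = ind {W : Set V | ∀ σ ∈ Sig', σ ∉ W} (sC U Y η) *
      ind (avoidAll (rest U Y η) Sig' Y') η := by
    intro η
    rw [hq]
    by_cases h : η ∈ avoidAll U Sig' Y'
    · have h' := (mem_avoidAll_iff_rest hYY' η).1 h
      rw [ind_of_mem h, ind_of_mem (show sC U Y η ∈ {W : Set V | ∀ σ ∈ Sig', σ ∉ W} from h'.1), one_mul, ind_of_mem h'.2]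
    · rw [ind_of_not_mem h]
      by_cases hW : ∀ σ ∈ Sig', σ ∉ sC U Y η
      · rw [ind_of_mem (show sC U Y η ∈ {W : Set V | ∀ σ ∈ Sig', σ ∉ W} from hW), one_mul, ind_of_not_mem]
        exact fun h'' => h ((mem_avoidAll_iff_rest hYY' η).2 ⟨hW, h''⟩)
      · rw [ind_of_not_mem (show sC U Y η ∉ {W : Set V | ∀ σ ∈ Sig', σ ∉ W} from hW), zero_mul]
  have hqP : ∀ η : Set (Sym2 V), ind {W : Set V | ∀ σ ∈ Sig', σ ∉ W} (sC U Y η) * PavN w (rest U Y η) Sig' Y' ∅ =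
      PavN w (rest U Y η) Sig' Y' ∅ := by
    intro η
    by_cases hW : ∀ σ ∈ Sig', σ ∉ sC U Y η
    · rw [ind_of_mem (show sC U Y η ∈ {W : Set V | ∀ σ ∈ Sig', σ ∉ W} from hW), one_mul]
    · rw [ind_of_not_mem (show sC U Y η ∉ {W : Set V | ∀ σ ∈ Sig', σ ∉ W} from hW), zero_mul, PavN]
      push Not at hW
      obtain ⟨σ, hσ, hσW⟩ := hW
      symm
      refine Finset.sum_eq_zero fun β _ => ?_
      rw [avoidAll_eq_empty_of_not_mem hσ (fun h' => (mem_rest.1 h').2 hσW), ind_of_not_mem (Set.notMem_empty β), mul_zero]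
  -- (1) `E[Θ_U] = 0`
  have h1 : ∑ η, weight w η * ΘU η = 0 := by
    have h := sum_ind_rD_mul_g_rC w hm U x Y g
    rw [← sub_eq_zero, ← Finset.sum_sub_distrib] at h
    rw [← h]
    exact Finset.sum_congr rfl fun η _ => by rw [hΘU]; ring
  -- (2) `E[Θ_U q] ≤ 0`: Harris in the worlds `U ∖ C_Y`
  have hcov : ∀ R : Finset V, ∑ β, weight w β * ((g (rC R x β) - tfE w R x g) * ind (avoidAll R Sig' Y') β) ≤ 0 := by
    intro R
    have h := harris_mono_anti hw0 hw1 hm (f := fun β => g (rC R x β)) (g := ind (avoidAll R Sig' Y'))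
      (fun β => hg0 _) (fun a b hab => hg (rC_mono R x hab)) (ind_avoidAll_antitone R Sig' Y') (M := 1)
      (fun β => ind_le_one _ _)
    have e : ∑ β, weight w β * ((g (rC R x β) - tfE w R x g) * ind (avoidAll R Sig' Y') β) =
        ∑ β, weight w β * (g (rC R x β) * ind (avoidAll R Sig' Y') β) -
          tfE w R x g * ∑ β, weight w β * ind (avoidAll R Sig' Y') β := by
      rw [Finset.mul_sum, ← Finset.sum_sub_distrib]
      exact Finset.sum_congr rfl fun β _ => by ring
    rw [e, tfE]
    linarith
  have h2 : ∑ η, weight w η * (ΘU η * q η) ≤ 0 := by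
    set Φ : Set V → Set (Sym2 V) → ℝ := fun W β =>
      (ind {W : Set V | x ∉ W} W * ind {W : Set V | ∀ σ ∈ Sig', σ ∉ W} W) *
        ((g (rC (U.filter fun a => a ∉ W) x β) - tfE w (U.filter fun a => a ∉ W) x g) *
          ind (avoidAll (U.filter fun a => a ∉ W) Sig' Y') β) with hΦ
    have markov := sum_cond_sC w hm U Y Φ
    have lhs : ∑ η, weight w η * (ΘU η * q η) = ∑ η, weight w η * Φ (sC U Y η) (η ∩ edgesIn (rest U Y η)) := by
      refine Finset.sum_congr rfl fun η _ => ?_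
      congr 1
      rw [hqη η, hΦ, hΘU]
      dsimp only
      rw [ind_not_mem_sC_eq, ← rest_eq_filter, rC_inter_edgesIn, ind_avoidAll_inter_edgesIn]
      by_cases hx : x ∈ sC U Y η
      · rw [ind_of_not_mem (fun h' => ((not_mem_sC_iff U Y η x).2 h') hx)]; ring
      · rw [rC_rest_of_not_mem hx]; ring
    have rhs : ∀ η : Set (Sym2 V), ∑ β, weight w β * Φ (sC U Y η) (β ∩ edgesIn (rest U Y η)) =
        (ind (rD U x Y) η * ind {W : Set V | ∀ σ ∈ Sig', σ ∉ W} (sC U Y η)) *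
          ∑ β, weight w β * ((g (rC (rest U Y η) x β) - tfE w (rest U Y η) x g) *
            ind (avoidAll (rest U Y η) Sig' Y') β) := by
      intro η
      rw [Finset.mul_sum]
      refine Finset.sum_congr rfl fun β _ => ?_
      rw [hΦ]
      dsimp only
      rw [ind_not_mem_sC_eq, ← rest_eq_filter, rC_inter_edgesIn, ind_avoidAll_inter_edgesIn]
      ring
    rw [lhs, markov]
    refine Finset.sum_nonpos fun η _ => mul_nonpos_iff.2 (Or.inl ⟨weight_nonneg hw0 hw1 η, ?_⟩)
    rw [rhs]
    exact mul_nonpos_iff.2 (Or.inl ⟨mul_nonneg (ind_nonneg _ _) (ind_nonneg _ _), hcov _⟩)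
  -- (3) `E[δ′ q] = Y_{P(∅)·gain}(Y)`, `E[δ′] = Y_{gain}(Y)`, `E[q] = P(Y)`
  have h3 : ∑ η, weight w η * (δ η * q η) = Yw w U x (fun U' => PavN w U' Sig' Y' ∅ * gainF w K x g U') Y := by
    set Φ : Set V → Set (Sym2 V) → ℝ := fun W β =>
      (ind {W : Set V | x ∉ W} W * gainF w K x g (U.filter fun a => a ∉ W) * ind {W : Set V | ∀ σ ∈ Sig', σ ∉ W} W) *
        ind (avoidAll (U.filter fun a => a ∉ W) Sig' Y') β with hΦ
    have markov := sum_cond_sC w hm U Y Φ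
    have lhs : ∑ η, weight w η * (δ η * q η) = ∑ η, weight w η * Φ (sC U Y η) (η ∩ edgesIn (rest U Y η)) := by
      refine Finset.sum_congr rfl fun η _ => ?_
      congr 1
      rw [hqη η, hΦ, hδ]
      dsimp only
      rw [ind_not_mem_sC_eq, ← rest_eq_filter, ind_avoidAll_inter_edgesIn]
      ring
    rw [lhs, markov, Yw]
    refine Finset.sum_congr rfl fun η _ => ?_
    congr 1
    have e : ∑ β, weight w β * Φ (sC U Y η) (β ∩ edgesIn (rest U Y η)) =
        (ind (rD U x Y) η * gainF w K x g (rest U Y η) * ind {W : Set V | ∀ σ ∈ Sig', σ ∉ W} (sC U Y η)) *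
          PavN w (rest U Y η) Sig' Y' ∅ := by
      rw [PavN, Finset.mul_sum]
      refine Finset.sum_congr rfl fun β _ => ?_
      rw [hΦ]
      dsimp only
      rw [ind_not_mem_sC_eq, ← rest_eq_filter, ind_avoidAll_inter_edgesIn, Set.union_empty]
      ring
    rw [e, mul_assoc, hqP η]
    ring
  have h4 : ∑ η, weight w η * δ η = Yw w U x (gainF w K x g) Y := by
    rw [Yw]
    exact Finset.sum_congr rfl fun η _ => by rw [hδ]; ring
  have h5 : ∑ η, weight w η * q η = PavN w U Sig' Y' Y := by
    rw [PavN, Set.union_eq_left.2 hYY']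
  -- (4) META-A2 diagonal and assembly
  have h6 := p1Gain w hw0 hw1 hm K x hg Sig' Y' hUK hYU
  rw [← h3, ← h4, ← h5] at h6
  have eL : ∑ η, weight w η * ((ΘU η - δ η) * q η) =
      ∑ η, weight w η * (ΘU η * q η) - ∑ η, weight w η * (δ η * q η) := by
    rw [← Finset.sum_sub_distrib]
    exact Finset.sum_congr rfl fun η _ => by ring
  have eR : ∑ η, weight w η * (ΘU η - δ η) = ∑ η, weight w η * ΘU η - ∑ η, weight w η * δ η := by
    rw [← Finset.sum_sub_distrib]
    exact Finset.sum_congr rfl fun η _ => by ring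
  rw [eL, eR, h1]
  nlinarith [h2, h6]

end Summit.CriticalPhenomena.PercolationContinuityZ3.Theorems.CovTau
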